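import Summits.ResolutionOfSingularities.ResolutionOfSingularities.Theses.JacobianBudget
import Summits.ResolutionOfSingularities.ResolutionOfSingularities.Theorems.JacobianBudgetIsolatedJacobianDropSurface

/-!
# Crux `IsolatedJacobianDrop` (stmt-ResolutionOfSingularities-18946, route `JacobianBudget`) —
# the crux BY NAME reduced to the wild regime `p` odd, `n ≥ 3`

Leaf over `Theorems/JacobianBudgetIsolatedJacobianDropSurface.lean` (`singleStepDrop_classical`: the
one-step budget in the classical regimes `n ≤ 2 ∨ p = 2`): the crux
`Theses.JacobianBudget.IsolatedJacobianDrop` follows from its one-step form in the WILD regime alone —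
`p` an odd prime and `n ≥ 3` variables (`isolatedJacobianDrop_of_wild`). The hypothesis is the binder
shape of `JacobianBudget.SingleStepDrop` (`Theorems/JacobianBudgetDefs.lean`) with `p ≠ 2`, `3 ≤ n`
added, over the named calculus `step/Isol/MultP/mu` of `Theorems/WildConesClassicalRegimesDefs.lean`,
the decrement written out as the crux's `let Δ`; the proof unfolds the crux's fourteen `let`s
definitionally (`run (m+1) = step (i m) (t m) (run m)`) and splits on the regime. Supersedes in scope
the reduction to odd primes `isolatedJacobianDrop_of_odd`
(`Theorems/JacobianBudgetIsolatedJacobianDropOddReduction.lean`).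

This file imports the route thesis file directly because it concludes the crux BY NAME (chain W4.1
import discipline: leaves only). BANK item of chain W4.1 (campaign res-hironaka, rung L, slot W4.1),
explicitly not summit progress. Everything here is OURS; it replaces the role of no printed item and is
NOT a statement of Hironaka's manuscript. [folklore]
-/

noncomputable section

-- single-problem summit: the doubled namespace component `ResolutionOfSingularities` is forced
set_option linter.dupNamespace false

open scoped BigOperators Classical

open Summit.ResolutionOfSingularities.ResolutionOfSingularities.Theses.JacobianBudget (IsolatedJacobianDrop)
open Summit.ResolutionOfSingularities.ResolutionOfSingularities.Theorems.WildCones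
  (step run Isol MultP mu)

namespace Summit.ResolutionOfSingularities.ResolutionOfSingularities.Theorems.JacobianBudget

/-- **THE CRUX `IsolatedJacobianDrop` BY NAME, REDUCED TO THE WILD REGIME.** If the one-step budget
`μ(step i τ c) + Δ_n(p) ≤ μ(c)` holds at isolated multiplicity-`p` steps for every ODD prime `p` in
`n ≥ 3` variables, then `Theses.JacobianBudget.IsolatedJacobianDrop` holds: the classical regimes
`n ≤ 2 ∨ p = 2` are `singleStepDrop_classical`. OURS; NOT a statement of Hironaka's manuscript.
[folklore] -/
theorem isolatedJacobianDrop_of_wild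
    (hwild : ∀ p : ℕ, p.Prime → p ≠ 2 → ∀ n : ℕ, 3 ≤ n → ∀ (κ : Type) [Field κ] [CharP κ p]
      [PerfectField κ] (c : (Fin n → ℕ) → κ) (i : Fin n) (τ : Fin n → κ),
      Isol p n κ c → MultP p n κ c → Isol p n κ (step p n κ i τ c) → MultP p n κ (step p n κ i τ c) →
        mu p n κ (step p n κ i τ c) + ((p - 1) ^ n * (p + 1) + 1 - 2 * ((n + 1) % 2)) / p ≤
          mu p n κ c) :
    IsolatedJacobianDrop := by
  intro p hp n hn κ _ _ _ c₀ i t _ _ _ _ _ _ _ _ _ _ _ _ _ _ m k1 k2 k3 k4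
  by_cases hreg : n ≤ 2 ∨ p = 2
  · exact singleStepDrop_classical p hp n hn hreg κ (run p n κ c₀ i t m) (i m) (t m) k1 k2 k3 k4
  · push Not at hreg
    exact hwild p hp hreg.2 n (by omega) κ (run p n κ c₀ i t m) (i m) (t m) k1 k2 k3 k4

end Summit.ResolutionOfSingularities.ResolutionOfSingularities.Theorems.JacobianBudget

end
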